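import Literature.AnabelianGeometry.EtaleTheta.KummerClass
import Literature.AlgebraicGeometry.Frobenioids.KummerClass
import Mathlib.RepresentationTheory.Homological.GroupCohomology.Functoriality
import Mathlib.Algebra.Group.Units.Equiv
import Mathlib.Topology.Algebra.Monoid
import Mathlib.Topology.LocallyConstant.Basic

/-!
# One Kummer theory: the `Λ`-adic Kummer class vs. the level-`N` Kummer class, and continuity

Bridge file of the abc-iut cell (layer L2, [EtTh]); it identifies the two Kummer constructions of
the tree and supplies the continuity statements that let their cocycles live in continuous
cohomology.

* `Literature.AlgebraicGeometry.Frobenioids.Kummer.kummerCocycle` / `Kummer.kummerClassOfRoot`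
  (file `Frobenioids/KummerClass.lean`) — Mochizuki, *The geometry of Frobenioids II*, Def. 2.1 (ii),
  p. 16: LEVEL `N`. For a commutative monoid `O` with an action of `Γ`, an `H`-invariant `f` and an
  `N`-th root `g` of `f`: the cocycle `h ↦ ζ_h ∈ μ_N(O)` with `h • g = ζ_h · g`, and its class in
  `H¹(H, μ_N(O))`.
* `Literature.AnabelianGeometry.EtaleTheta.RootSystem.kummerCocycle` / `kummerClassOfRootSystem`
  (file `EtaleTheta/KummerClass.lean`) — LANA report §6.1, p. 31, "taking limits in `n`":
  `Λ`-ADIC. For a compatible system of roots `x = (x_n)_n` of `a`: the cocycle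
  `h ↦ (h • x_n / x_n)_n ∈ Λ(A) = lim_n A[n]`, and its class in `H¹(H, Λ(A))`.

The second construction is the first one passed to the inverse limit over `n`. This file PROVES
exactly that, so that the tree carries ONE Kummer theory with a proved bridge:

1. `nthRootsDifferByUnits_of_commGroup` — in a commutative GROUP the torsor hypothesis of [FrdII]
   Def. 2.1 (ii) ("two `N`-th roots differ by a unit") holds for free, and `coe_levelKummerCocycle`:
   the [FrdII] cocycle is then literally `h ↦ h • g / g`.
2. `cyclotome.toMu n : Λ(A) →* μ_n(A)` — the `n`-th projection of the inverse limit, equivariant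
   (`cyclotome.toMu_smul`).
3. `RootSystem.toMu_kummerCocycle` — projecting the `Λ`-adic cocycle of `x` to level `n` gives
   the [FrdII] cocycle of the root `x_n`, on the nose.
4. `H1ToLevel H n : H¹(H, Λ(A)) ⟶ H¹(H, μ_n(A))` (Mathlib `groupCohomology.map` along
   `cyclotomeRepToMu`) and `H1ToLevel_kummerClassOfRootSystem`: it sends the `Λ`-adic Kummer class
   of `a` to the [FrdII] Kummer class of `a` at level `n` computed with ANY `n`-th root (root
   independence on both sides); `H1ToLevel_kummerClass`: the same for the Kummer map of a rootable
   group, through `invariantsToKummerDomain`.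
5. CONTINUITY. The groups of [EtTh] are topological (tempered / profinite) and its `H¹` is
   continuous cohomology, whereas both files above are deliberately discrete. If the acting group is
   a topological group and the stabiliser of the root is OPEN — condition (ii) of the equivalent
   conditions for a discrete module in Neukirch, *Class Field Theory — The Bonn Lectures*, Part II
   §1, p. 80 — then the orbit map `g ↦ g • b` is locally constant
   (`isLocallyConstant_smul_of_isOpen_stabilizer`), every level of the `Λ`-adic Kummer cocycle is
   locally constant, hence continuous (`RootSystem.isLocallyConstant_kummerCocycle_apply`,
   `RootSystem.continuous_kummerCocycle_apply`), the whole cocycle is continuous into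
   `Λ(A) ⊆ ∏_n A` for the limit (product-of-discrete) topology (`RootSystem.continuous_kummerCocycle`),
   and the level-`N` [FrdII] cocycle is locally constant (`isLocallyConstant_levelKummerCocycle`).
   So these cocycles ARE continuous `1`-cocycles; their classes in the continuous `H¹` of
   `EtaleTheta/ContH1.lean` are assembled in the companion file `EtaleTheta/KummerContH1.lean`.

Scope statement (supersedes "for the finite coefficient modules of the source this loses nothing"
in the module docstring of `EtaleTheta/KummerClass.lean`): the discrete `H¹` of a topological group
is in general LARGER than the continuous one (non-continuous crossed homomorphisms exist); what is
true — and proved below — is that the Kummer COCYCLES are continuous under the open-stabiliser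
hypothesis, so their classes come from the continuous `H¹`.

Universe: Mathlib's multiplicative-cocycle API for `Rep ℤ H` and the [FrdII] file are stated in
`Type`, so every statement mentioning `μ_n` or `H¹` takes its groups in `Type`; the purely
topological statements about the `Λ`-adic cocycle are universe-polymorphic.
-/

namespace Literature.AnabelianGeometry.EtaleTheta

open groupCohomology CategoryTheory
open Literature.AlgebraicGeometry.Frobenioids

/-! ### The [FrdII] level-`N` cocycle in a commutative group -/

section GroupCase

variable {G : Type} [Group G] {A : Type} [CommGroup A] [MulDistribMulAction G A]

variable (A) in
/-- In a commutative GROUP the torsor hypothesis of [FrdII] Def. 2.1 (ii) — "two `N`-th roots of the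
same element differ by a unit" ([FrdI] Def. 1.3 (vi) in a Frobenioid) — holds for free: every element
is a unit. [cite: MochizukiFrdII2008, Def 2.1 (ii) p.16] -/
theorem nthRootsDifferByUnits_of_commGroup (N : ℕ) : Kummer.NthRootsDifferByUnits N A :=
  ⟨fun g g' _ => ⟨toUnits (g' / g), by rw [val_toUnits_apply, div_mul_cancel]⟩⟩

/-- In a commutative group the [FrdII] Kummer cocycle of the root `g` of the `H`-invariant `f` is
`h ↦ h • g / g` (the unique `ζ_h` with `h • g = ζ_h · g`). [cite: MochizukiFrdII2008, Def 2.1 (ii) p.16] -/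
theorem coe_levelKummerCocycle {N : ℕ} (hO : Kummer.NthRootsDifferByUnits N A) (H : Subgroup G)
    {f g : A} (hg : g ^ N = f) (hf : ∀ h : H, (h : G) • f = f) (h : H) :
    ((Kummer.kummerCocycle hO H hg hf h).val : A) = (h : G) • g / g := by
  have e : Kummer.kummerCocycle hO H hg hf h =
      Kummer.Mu.mk (toUnits ((h : G) • g / g))
        ((mem_rootsOfUnity' N _).2 (by
          rw [val_toUnits_apply, div_pow, ← smul_pow', hg, hf h, div_self'])) :=
    Kummer.kummerCocycle_eq_of_smul_eq hO H hg hf h (by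
      rw [Kummer.Mu.val_mk, val_toUnits_apply, div_mul_cancel])
  rw [e, Kummer.Mu.val_mk, val_toUnits_apply]

end GroupCase

/-! ### The level-`n` projection `Λ(A) → μ_n(A)` -/

namespace cyclotome

variable {A : Type} [CommGroup A]

/-- The `n`-th projection of the inverse limit `Λ(A) = lim_m A[m]` onto `A[n] = μ_n(A)`
(`Kummer.Mu n A`, [FrdII] Def. 2.1 (i)): `ζ ↦ ζ_n`. This is the map along which "taking limits in
`n`" [cite: LANA2026Report, §6.1 p.31] is undone. -/
def toMu (n : ℕ+) : cyclotome A →* Kummer.Mu (n : ℕ) A where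
  toFun ζ := Kummer.Mu.mk (toUnits ((ζ : ℕ+ → A) n))
    ((mem_rootsOfUnity' (n : ℕ) _).2 (by rw [val_toUnits_apply, cyclotome.pow_eq_one]))
  map_one' := Kummer.Mu.ext (Units.ext (by
    rw [Kummer.Mu.val_mk, val_toUnits_apply, Kummer.Mu.val_one, Units.val_one]
    rfl))
  map_mul' ζ ξ := Kummer.Mu.ext (Units.ext (by
    rw [Kummer.Mu.val_mk, val_toUnits_apply, Kummer.Mu.val_mul, Units.val_mul, Kummer.Mu.val_mk,
      Kummer.Mu.val_mk, val_toUnits_apply, val_toUnits_apply]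
    rfl))

/-- `toMu n ζ`, as an element of `A`, is the `n`-th component `ζ_n`.
[cite: LANA2026Report, §6.1 p.31] -/
@[simp] theorem coe_val_toMu (n : ℕ+) (ζ : cyclotome A) :
    ((toMu n ζ).val : A) = (ζ : ℕ+ → A) n := rfl

variable {G : Type} [Group G] [MulDistribMulAction G A]

/-- The level-`n` projection is `G`-equivariant (both actions are induced by the action on `A`).
[cite: LANA2026Report, §6.1 p.31] -/
theorem toMu_smul (n : ℕ+) (g : G) (ζ : cyclotome A) : toMu n (g • ζ) = g • toMu n ζ :=
  Kummer.Mu.ext (Units.ext (by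
    rw [coe_val_toMu, Kummer.Mu.val_smul, Kummer.coe_unitsAct, coe_val_toMu, cyclotome.smul_apply]))

end cyclotome

/-! ### Level `n` of the `Λ`-adic cocycle is the [FrdII] cocycle -/

section Comparison

variable {G : Type} [Group G] {A : Type} [CommGroup A] [MulDistribMulAction G A]
variable (H : Subgroup G) {a : A}

/-- **Cocycle-level comparison.** Projecting the `Λ`-adic Kummer cocycle of the compatible root
system `x` of `a` [cite: LANA2026Report, §6.1 p.31] to level `n` gives, on the nose, the [FrdII]
Def. 2.1 (ii) Kummer cocycle of the `n`-th root `x_n` of `a`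
(`Literature.AlgebraicGeometry.Frobenioids.Kummer.kummerCocycle`). -/
theorem RootSystem.toMu_kummerCocycle (n : ℕ+) (hO : Kummer.NthRootsDifferByUnits (n : ℕ) A)
    (x : RootSystem a) (ha : a ∈ MulAction.fixedPoints H A) (hf : ∀ h : H, (h : G) • a = a)
    (h : H) :
    cyclotome.toMu n (x.kummerCocycle ha h) = Kummer.kummerCocycle hO H (x.pow_self n) hf h := by
  symm
  apply Kummer.kummerCocycle_eq_of_smul_eq
  rw [cyclotome.coe_val_toMu, RootSystem.kummerCocycle_apply]
  change (h : G) • x.root n = (h : G) • x.root n / x.root n * x.root n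
  rw [div_mul_cancel]

/-- The same comparison read in `A`: the `n`-th component of the `Λ`-adic cocycle and the underlying
element of the [FrdII] cocycle of `x_n` are both `h • x_n / x_n`. [cite: LANA2026Report, §6.1 p.31] -/
theorem RootSystem.kummerCocycle_apply_eq_coe_levelKummerCocycle (n : ℕ+)
    (hO : Kummer.NthRootsDifferByUnits (n : ℕ) A) (x : RootSystem a)
    (ha : a ∈ MulAction.fixedPoints H A) (hf : ∀ h : H, (h : G) • a = a) (h : H) :
    ((x.kummerCocycle ha h : cyclotome A) : ℕ+ → A) n =
      ((Kummer.kummerCocycle hO H (x.pow_self n) hf h).val : A) := by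
  rw [← RootSystem.toMu_kummerCocycle H n hO x ha hf h, cyclotome.coe_val_toMu]

/-- The level-`n` projection `Λ(A) → μ_n(A)` as a morphism of `ℤ`-linear `H`-representations
(Mathlib `Rep`), from `cyclotomeRep H` to the coefficient object of the [FrdII] Kummer class.
[cite: LANA2026Report, §6.1 p.31] -/
noncomputable def cyclotomeRepToMu (n : ℕ+) :
    cyclotomeRep (A := A) H ⟶ Rep.ofMulDistribMulAction H (Kummer.Mu (n : ℕ) A) :=
  Rep.ofHom
    { toLinearMap := (MonoidHom.toAdditive (cyclotome.toMu (A := A) n)).toIntLinearMap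
      isIntertwining' := fun h =>
        LinearMap.ext fun v => cyclotome.toMu_smul n (h : G) (Additive.toMul (α := cyclotome A) v) }

/-- `cyclotomeRepToMu` on elements. [cite: LANA2026Report, §6.1 p.31] -/
@[simp] theorem cyclotomeRepToMu_hom_apply (n : ℕ+) (v : Additive (cyclotome A)) :
    (cyclotomeRepToMu H n).hom v = Additive.ofMul (cyclotome.toMu n v.toMul) := rfl

/-- **`H¹(H, Λ(A)) ⟶ H¹(H, μ_n(A))`**, the map induced on first cohomology by the level-`n`
projection (Mathlib `groupCohomology.map` in degree `1` along the identity of `H`).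
[cite: LANA2026Report, §6.1 p.31] -/
noncomputable abbrev H1ToLevel (n : ℕ+) :
    H1 (cyclotomeRep (A := A) H) ⟶ H1 (Rep.ofMulDistribMulAction H (Kummer.Mu (n : ℕ) A)) :=
  groupCohomology.map (MonoidHom.id H) (cyclotomeRepToMu H n) 1

/-- **Class-level comparison.** The level-`n` image of the `Λ`-adic Kummer class of `a`
(computed with any compatible root system `x`, [cite: LANA2026Report, §6.1 p.31]) is the [FrdII]
Def. 2.1 (ii) Kummer class of `a` at level `n` computed with ANY `n`-th root `g`
(`Kummer.kummerClassOfRoot`; root independence is `Kummer.kummerClass_eq_of_pow_eq` there and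
`kummerClassOfRootSystem_eq` here). -/
theorem H1ToLevel_kummerClassOfRootSystem (n : ℕ+) (hO : Kummer.NthRootsDifferByUnits (n : ℕ) A)
    (x : RootSystem a) (ha : a ∈ MulAction.fixedPoints H A) {g : A} (hg : g ^ (n : ℕ) = a)
    (hf : ∀ h : H, (h : G) • a = a) :
    H1ToLevel H n (kummerClassOfRootSystem H x ha) = Kummer.kummerClassOfRoot hO H hg hf := by
  rw [Kummer.kummerClass_eq_of_pow_eq hO H hg (x.pow_self n) hf, kummerClassOfRootSystem,
    Kummer.kummerClassOfRoot, H1ToLevel, H1π_comp_map_apply]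
  congr 1
  refine cocycles₁_ext fun h => ?_
  rw [coe_mapCocycles₁]
  change (cyclotomeRepToMu H n).hom (kummerCocycles₁ H x ha h) =
    Additive.ofMul (Kummer.kummerCocycle hO H (x.pow_self n) hf h)
  rw [← RootSystem.toMu_kummerCocycle H n hO x ha hf h]
  rfl

variable [RootableBy A ℕ]

/-- In a rootable group every `H`-invariant element has `n`-th roots, so `A^H` maps to the domain
`O^{H} ∩ O^N` of the [FrdII] Kummer map (`Kummer.kummerDomain`), with the root taken from the
compatible system `RootSystem.ofRootableBy`. [cite: MochizukiFrdII2008, Def 2.1 (ii) p.16] -/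
def invariantsToKummerDomain (n : ℕ+) :
    invariants (A := A) H →* Kummer.kummerDomain (n : ℕ) A H where
  toFun a := ⟨(a : A), fun h => a.2 h, (RootSystem.ofRootableBy (a : A)).root n,
    RootSystem.pow_self _ n⟩
  map_one' := rfl
  map_mul' _ _ := rfl

/-- Underlying element of `invariantsToKummerDomain`. [cite: MochizukiFrdII2008, Def 2.1 (ii) p.16] -/
@[simp] theorem coe_invariantsToKummerDomain (n : ℕ+) (a : invariants (A := A) H) :
    ((invariantsToKummerDomain H n a : Kummer.kummerDomain (n : ℕ) A H) : A) = a := rfl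

/-- **The Kummer maps agree**: the level-`n` image of the `Λ`-adic Kummer class `κ(a) ∈ H¹(H, Λ(A))`
of [cite: LANA2026Report, §6.1 p.31] is the [FrdII] Def. 2.1 (ii) Kummer class
`κ_a ∈ H¹(H, μ_n(A))` (`Kummer.kummerClass`). -/
theorem H1ToLevel_kummerClass (n : ℕ+) (hO : Kummer.NthRootsDifferByUnits (n : ℕ) A)
    (a : invariants (A := A) H) :
    H1ToLevel H n (kummerClass H a) =
      Kummer.kummerClass hO H (invariantsToKummerDomain H n a) := by
  rw [Kummer.kummerClass_eq hO H (invariantsToKummerDomain H n a)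
    (g := (RootSystem.ofRootableBy (a : A)).root n) (RootSystem.pow_self _ n), kummerClass]
  exact H1ToLevel_kummerClassOfRootSystem H n hO _ a.2 _ _

/-- The same agreement for the bundled homomorphisms: `H1ToLevel ∘ kummerMapFixed` equals the
[FrdII] Kummer map `Kummer.kummerMap` precomposed with `invariantsToKummerDomain` (additive
notation on `H¹`). [cite: LANA2026Report, §6.1 p.31] -/
theorem H1ToLevel_comp_kummerMapFixed (n : ℕ+) (hO : Kummer.NthRootsDifferByUnits (n : ℕ) A) :
    (H1ToLevel H n).hom.toAddMonoidHom.comp (kummerMapFixed H) =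
      (MonoidHom.toAdditiveLeft (Kummer.kummerMap hO H)).comp
        (MonoidHom.toAdditive (invariantsToKummerDomain H n)) := by
  ext a
  exact H1ToLevel_kummerClass H n hO a

end Comparison

/-! ### Continuity: open stabilisers make the Kummer cocycles locally constant -/

section Continuity

variable {G : Type*} [Group G] [TopologicalSpace G] [SeparatelyContinuousMul G]

/-- If the stabiliser of `b` is open, the orbit map `g ↦ g • b` is locally constant (constant on
the open coset `g₀ · Stab(b)` around each `g₀`): condition (ii) of the equivalent conditions
"(i) `G × A → A` is continuous [for `A` discrete], (ii) every stabiliser is open,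
(iii) `A = ⋃_U A^U`" of [cite: Neukirch2013, II §1 p.80]. -/
theorem isLocallyConstant_smul_of_isOpen_stabilizer {α : Type*} [MulAction G α] (b : α)
    (hb : IsOpen (MulAction.stabilizer G b : Set G)) : IsLocallyConstant fun g : G => g • b := by
  refine (IsLocallyConstant.iff_exists_open _).2 fun g₀ => ?_
  refine ⟨(fun g => g₀⁻¹ * g) ⁻¹' (MulAction.stabilizer G b : Set G),
    hb.preimage (continuous_const_mul g₀⁻¹), ?_, fun g hg => ?_⟩
  · rw [Set.mem_preimage, inv_mul_cancel]
    exact (MulAction.stabilizer G b).one_mem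
  · rw [Set.mem_preimage, SetLike.mem_coe, MulAction.mem_stabilizer_iff] at hg
    calc g • b = (g₀ * (g₀⁻¹ * g)) • b := by rw [mul_inv_cancel_left]
      _ = g₀ • b := by rw [mul_smul, hg]

variable {A : Type*} [CommGroup A] [MulDistribMulAction G A] {H : Subgroup G} {a : A}

/-- **Continuity bridge, level by level.** If the stabiliser of the root `x_n` is open, the `n`-th
component `h ↦ h • x_n / x_n` of the `Λ`-adic Kummer cocycle [cite: LANA2026Report, §6.1 p.31] is a
locally constant function on `H` (for the subspace topology). -/
theorem RootSystem.isLocallyConstant_kummerCocycle_apply (x : RootSystem a)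
    (ha : a ∈ MulAction.fixedPoints H A) (n : ℕ+)
    (hx : IsOpen (MulAction.stabilizer G (x.root n) : Set G)) :
    IsLocallyConstant fun h : H => ((x.kummerCocycle ha h : cyclotome A) : ℕ+ → A) n := by
  have h1 : IsLocallyConstant fun h : H => (h : G) • x.root n :=
    (isLocallyConstant_smul_of_isOpen_stabilizer (x.root n) hx).comp_continuous
      continuous_subtype_val
  exact h1.div (IsLocallyConstant.const (x.root n))

/-- Hence each component of the `Λ`-adic Kummer cocycle is continuous, for ANY topology on `A`
(in [EtTh]/[FrdII] the coefficient modules `μ_N` are finite discrete). [cite: LANA2026Report, §6.1 p.31] -/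
theorem RootSystem.continuous_kummerCocycle_apply [TopologicalSpace A] (x : RootSystem a)
    (ha : a ∈ MulAction.fixedPoints H A) (n : ℕ+)
    (hx : IsOpen (MulAction.stabilizer G (x.root n) : Set G)) :
    Continuous fun h : H => ((x.kummerCocycle ha h : cyclotome A) : ℕ+ → A) n :=
  (x.isLocallyConstant_kummerCocycle_apply ha n hx).continuous

/-- **Continuity of the `Λ`-adic Kummer cocycle** `H → Λ(A)`, where `Λ(A) ⊆ ∏_n A` carries the
subspace-of-product topology (= the inverse-limit topology "considered as a (topological)
`G`-module", [cite: LANA2026Report, §6.1 p.31], when `A` is discrete), provided all the roots `x_n`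
have open stabilisers. -/
theorem RootSystem.continuous_kummerCocycle [TopologicalSpace A] (x : RootSystem a)
    (ha : a ∈ MulAction.fixedPoints H A)
    (hx : ∀ n : ℕ+, IsOpen (MulAction.stabilizer G (x.root n) : Set G)) :
    Continuous (x.kummerCocycle ha : H → cyclotome A) :=
  continuous_induced_rng.2 (continuous_pi fun n => x.continuous_kummerCocycle_apply ha n (hx n))

/-- If every point of `A` has an open stabiliser (the action of `G` on the discrete module `A` is
continuous, [cite: Neukirch2013, II §1 p.80]), the `Λ`-adic Kummer cocycle of every compatible root
system is continuous. -/
theorem RootSystem.continuous_kummerCocycle_of_forall_isOpen_stabilizer [TopologicalSpace A]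
    (hA : ∀ b : A, IsOpen (MulAction.stabilizer G b : Set G)) (x : RootSystem a)
    (ha : a ∈ MulAction.fixedPoints H A) :
    Continuous (x.kummerCocycle ha : H → cyclotome A) :=
  x.continuous_kummerCocycle ha fun n => hA (x.root n)

end Continuity

section LevelContinuity

variable {Γ : Type} [Group Γ] [TopologicalSpace Γ] [SeparatelyContinuousMul Γ]
  {N : ℕ} {O : Type} [CommMonoid O] [MulDistribMulAction Γ O] [IsCancelMul O]

/-- **Continuity bridge at level `N`** (general monoid setting of [FrdII] Def. 2.1 (ii)
[cite: MochizukiFrdII2008, Def 2.1 (ii) p.16]): if the stabiliser of the root `g` in the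
topological group `Γ` is open, the Kummer cocycle `h ↦ ζ_h` (`h • g = ζ_h · g`) is locally
constant on `H`, i.e. continuous for the discrete topology on `μ_N(O)`. -/
theorem isLocallyConstant_levelKummerCocycle (hO : Kummer.NthRootsDifferByUnits N O)
    (H : Subgroup Γ) {f g : O} (hg : g ^ N = f) (hf : ∀ h : H, (h : Γ) • f = f)
    (hopen : IsOpen (MulAction.stabilizer Γ g : Set Γ)) :
    IsLocallyConstant (Kummer.kummerCocycle hO H hg hf) := by
  have h1 : IsLocallyConstant fun h : H => (h : Γ) • g :=
    (isLocallyConstant_smul_of_isOpen_stabilizer g hopen).comp_continuous continuous_subtype_val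
  rw [IsLocallyConstant.iff_eventually_eq] at h1 ⊢
  intro h₀
  filter_upwards [h1 h₀] with h hh
  exact Kummer.kummerCocycle_eq_of_smul_eq hO H hg hf h
    (by rw [hh]; exact Kummer.smul_root_eq hO H hg hf h₀)

end LevelContinuity

end Literature.AnabelianGeometry.EtaleTheta
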